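import Summits.Ventures.PercRepro.StarGadgetPurePairG
import Summits.Ventures.PercRepro.StarGadgetPurePairS0P0N0
import Summits.Ventures.PercRepro.StarGadgetPurePairS0P0N1
import Summits.Ventures.PercRepro.StarGadgetPurePairS0P0N2A

/-!
# `G ≥ 0` at `s = 0, p = 0` (node n3): the zero leaf n9, node n10, the direction `n` of n11, and the assembly n11 → n7 → n5 → n3

One module of the exact certificate tree for `G` (data/mine-3/g20/single-p2.json, key `P[xc|xc]|cx=1`; one lemma per node:
half-space domination certificates, finite boxes, case splits `x = 0 / x ≥ 1`). The definition of `G` is in `StarGadgetPurePairG`;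
the theorem `G_nonneg` is in `StarGadgetPurePairNonneg`. A factor `(0:ℤ)^x` is the indicator `[x = 0]`.
-/

namespace PercRepro.StarGadget

/-- Node n9 of the certificate tree (zero leaf): `0 ≤ G 0 0 0 0 (n + 2)` — the slice is identically `0` (`unfold G; ring`). -/
theorem G_n9 (n : ℕ) : 0 ≤ G 0 0 0 0 (n + 1 + 1) := by
  have hz : G 0 0 0 0 (n + 1 + 1) = 0 := by
    unfold G
    ring
  exact le_of_eq hz.symm

/-- Half-space lemma of node n10 of the certificate tree (parent `G_n10`: `0 ≤ G 0 0 (r + 1) 0 (n + 2)`), direction `r` (the half-space `r ≥ 1` of the parent's variable): `0 ≤ G 0 0 (r + 2) 0 (n + 2)` — the exact domination certificate of record (data/mine-3/g20/single-p2.json, key `P[xc|xc]|cx=1`, node n10, direction r, N = 1): coordinatewise base monotonicity of the dominated monomials, positivity, `linarith`. -/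
theorem G_n10_dr (r n : ℕ) : 0 ≤ G 0 0 (r + 1 + 1) 0 (n + 1 + 1) := by
  have h0 : (4:ℤ)^r * 16^n ≤ (5:ℤ)^r * 32^n := by
    have := show (4:ℤ)^r * 16^n ≤ (5:ℤ)^r * 32^n by
      gcongr
      all_goals norm_num
    simpa using this
  have h1 : (4:ℤ)^r * 16^n ≤ (5:ℤ)^r * 16^n := by
    have := show (4:ℤ)^r * 16^n ≤ (5:ℤ)^r * 16^n by
      gcongr
      all_goals norm_num
    simpa using this
  have h2 : (2:ℤ)^r * 16^n ≤ (5:ℤ)^r * 32^n := by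
    have := show (2:ℤ)^r * 16^n ≤ (5:ℤ)^r * 32^n by
      gcongr
      all_goals norm_num
    simpa using this
  have h3 : (2:ℤ)^r * 32^n ≤ (5:ℤ)^r * 32^n := by
    have := show (2:ℤ)^r * 32^n ≤ (5:ℤ)^r * 32^n by
      gcongr
      all_goals norm_num
    simpa using this
  have h4 : (0:ℤ) ≤ (16:ℤ)^n := by positivity
  have h5 : (0:ℤ) ≤ (5:ℤ)^r * 32^n := by positivity
  have h6 : (0:ℤ) ≤ (5:ℤ)^r * 16^n := by positivity
  unfold G
  simp only [pow_add]
  norm_num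
  linarith [h0, h1, h2, h3, h4, h5, h6]

/-- Half-space lemma of node n10 of the certificate tree (parent `G_n10`: `0 ≤ G 0 0 (r + 1) 0 (n + 2)`), direction `n` (the half-space `n ≥ 1` of the parent's variable): `0 ≤ G 0 0 (r + 1) 0 (n + 3)` — the exact domination certificate of record (data/mine-3/g20/single-p2.json, key `P[xc|xc]|cx=1`, node n10, direction n, N = 1): coordinatewise base monotonicity of the dominated monomials, positivity, `linarith`. -/
theorem G_n10_dn (r n : ℕ) : 0 ≤ G 0 0 (r + 1) 0 (n + 1 + 1 + 1) := by
  have h0 : (4:ℤ)^r * 16^n ≤ (5:ℤ)^r * 32^n := by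
    have := show (4:ℤ)^r * 16^n ≤ (5:ℤ)^r * 32^n by
      gcongr
      all_goals norm_num
    simpa using this
  have h1 : (4:ℤ)^r * 16^n ≤ (5:ℤ)^r * 16^n := by
    have := show (4:ℤ)^r * 16^n ≤ (5:ℤ)^r * 16^n by
      gcongr
      all_goals norm_num
    simpa using this
  have h2 : (2:ℤ)^r * 16^n ≤ (5:ℤ)^r * 32^n := by
    have := show (2:ℤ)^r * 16^n ≤ (5:ℤ)^r * 32^n by
      gcongr
      all_goals norm_num
    simpa using this
  have h3 : (2:ℤ)^r * 32^n ≤ (5:ℤ)^r * 32^n := by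
    have := show (2:ℤ)^r * 32^n ≤ (5:ℤ)^r * 32^n by
      gcongr
      all_goals norm_num
    simpa using this
  have h4 : (0:ℤ) ≤ (16:ℤ)^n := by positivity
  have h5 : (0:ℤ) ≤ (5:ℤ)^r * 32^n := by positivity
  have h6 : (0:ℤ) ≤ (5:ℤ)^r * 16^n := by positivity
  unfold G
  simp only [pow_add]
  norm_num
  linarith [h0, h1, h2, h3, h4, h5, h6]

/-- Node n10 of the certificate tree (half-space node): `0 ≤ G 0 0 (r + 1) 0 (n + 2)` — the half-spaces `r ≥ 1`, `n ≥ 1` (direction lemmas `G_n10_d*`) and the remaining single point by `norm_num [G]`. -/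
theorem G_n10 (r n : ℕ) : 0 ≤ G 0 0 (r + 1) 0 (n + 1 + 1) := by
  by_cases hr : 1 ≤ r
  · obtain ⟨r, rfl⟩ := Nat.exists_eq_add_of_le' hr
    exact G_n10_dr r n
  by_cases hn : 1 ≤ n
  · obtain ⟨n, rfl⟩ := Nat.exists_eq_add_of_le' hn
    exact G_n10_dn r n
  push Not at hr hn
  obtain rfl : r = 0 := by omega
  obtain rfl : n = 0 := by omega
  norm_num [G]

/-- Node n8 of the certificate tree (case split on `r`): `0 ≤ G 0 0 r 0 (n + 2)` — `r = 0` by `G_n9`, `r ≥ 1` by `G_n10`. -/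
theorem G_n8 (r n : ℕ) : 0 ≤ G 0 0 r 0 (n + 1 + 1) := by
  rcases Nat.eq_zero_or_pos r with h | h
  · subst h
    exact G_n9 n
  · obtain ⟨r, rfl⟩ := Nat.exists_eq_add_of_le' h
    exact G_n10 r n

/-- Half-space lemma of node n11 of the certificate tree (parent `G_n11`: `0 ≤ G 0 (q + 1) r 0 (n + 2)`), direction `n` (the half-space `n ≥ 1` of the parent's variable): `0 ≤ G 0 (q + 1) r 0 (n + 3)` — the exact domination certificate of record (data/mine-3/g20/single-p2.json, key `P[xc|xc]|cx=1`, node n11, direction n, N = 1): coordinatewise base monotonicity of the dominated monomials, positivity, `linarith`. -/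
theorem G_n11_dn (q r n : ℕ) : 0 ≤ G 0 (q + 1) r 0 (n + 1 + 1 + 1) := by
  have h0 : (4:ℤ)^q * 4^r * 16^n ≤ (5:ℤ)^q * 5^r * 32^n := by
    have := show (4:ℤ)^q * 4^r * 16^n ≤ (5:ℤ)^q * 5^r * 32^n by
      gcongr
      all_goals norm_num
    simpa using this
  have h1 : (4:ℤ)^q * 4^r * 16^n ≤ (5:ℤ)^q * 4^r * 16^n := by
    have := show (4:ℤ)^q * 4^r * 16^n ≤ (5:ℤ)^q * 4^r * 16^n by
      gcongr
      all_goals norm_num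
    simpa using this
  have h2 : (4:ℤ)^q * 4^r * 16^n ≤ (4:ℤ)^q * 5^r * 16^n := by
    have := show (4:ℤ)^q * 4^r * 16^n ≤ (4:ℤ)^q * 5^r * 16^n by
      gcongr
      all_goals norm_num
    simpa using this
  have h3 : (2:ℤ)^q * 16^n ≤ (4:ℤ)^q * 16^n := by
    have := show (2:ℤ)^q * 1^r * 16^n ≤ (4:ℤ)^q * 1^r * 16^n by
      gcongr
      all_goals norm_num
    simpa using this
  have h4 : (2:ℤ)^q * 16^n ≤ (5:ℤ)^q * 2^r * 16^n := by
    have := show (2:ℤ)^q * 1^r * 16^n ≤ (5:ℤ)^q * 2^r * 16^n by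
      gcongr
      all_goals norm_num
    simpa using this
  have h5 : (2:ℤ)^r * 16^n ≤ (4:ℤ)^r * 16^n := by
    have := show (1:ℤ)^q * 2^r * 16^n ≤ (1:ℤ)^q * 4^r * 16^n by
      gcongr
      all_goals norm_num
    simpa using this
  have h6 : (2:ℤ)^r * 16^n ≤ (2:ℤ)^q * 2^r * 16^n := by
    have := show (1:ℤ)^q * 2^r * 16^n ≤ (2:ℤ)^q * 2^r * 16^n by
      gcongr
      all_goals norm_num
    simpa using this
  have h7 : (2:ℤ)^r * 16^n ≤ (5:ℤ)^q * 2^r * 16^n := by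
    have := show (1:ℤ)^q * 2^r * 16^n ≤ (5:ℤ)^q * 2^r * 16^n by
      gcongr
      all_goals norm_num
    simpa using this
  have h8 : (2:ℤ)^q * 2^r * 32^n ≤ (5:ℤ)^q * 5^r * 32^n := by
    have := show (2:ℤ)^q * 2^r * 32^n ≤ (5:ℤ)^q * 5^r * 32^n by
      gcongr
      all_goals norm_num
    simpa using this
  have h9 : (2:ℤ)^q * 4^r * 16^n ≤ (5:ℤ)^q * 5^r * 32^n := by
    have := show (2:ℤ)^q * 4^r * 16^n ≤ (5:ℤ)^q * 5^r * 32^n by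
      gcongr
      all_goals norm_num
    simpa using this
  have h10 : (2:ℤ)^q * 4^r * 16^n ≤ (3:ℤ)^q * 4^r * 16^n := by
    have := show (2:ℤ)^q * 4^r * 16^n ≤ (3:ℤ)^q * 4^r * 16^n by
      gcongr
      all_goals norm_num
    simpa using this
  have h11 : (2:ℤ)^q * 4^r * 16^n ≤ (2:ℤ)^q * 5^r * 16^n := by
    have := show (2:ℤ)^q * 4^r * 16^n ≤ (2:ℤ)^q * 5^r * 16^n by
      gcongr
      all_goals norm_num
    simpa using this
  have h12 : (4:ℤ)^q * 2^r * 16^n ≤ (5:ℤ)^q * 5^r * 32^n := by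
    have := show (4:ℤ)^q * 2^r * 16^n ≤ (5:ℤ)^q * 5^r * 32^n by
      gcongr
      all_goals norm_num
    simpa using this
  have h13 : (4:ℤ)^q * 2^r * 16^n ≤ (4:ℤ)^q * 3^r * 16^n := by
    have := show (4:ℤ)^q * 2^r * 16^n ≤ (4:ℤ)^q * 3^r * 16^n by
      gcongr
      all_goals norm_num
    simpa using this
  have h14 : (4:ℤ)^q * 2^r * 16^n ≤ (5:ℤ)^q * 2^r * 16^n := by
    have := show (4:ℤ)^q * 2^r * 16^n ≤ (5:ℤ)^q * 2^r * 16^n by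
      gcongr
      all_goals norm_num
    simpa using this
  have h15 : (5:ℤ)^q * 3^r * 16^n ≤ (5:ℤ)^q * 5^r * 32^n := by
    have := show (5:ℤ)^q * 3^r * 16^n ≤ (5:ℤ)^q * 5^r * 32^n by
      gcongr
      all_goals norm_num
    simpa using this
  have h16 : (3:ℤ)^q * 5^r * 16^n ≤ (5:ℤ)^q * 5^r * 32^n := by
    have := show (3:ℤ)^q * 5^r * 16^n ≤ (5:ℤ)^q * 5^r * 32^n by
      gcongr
      all_goals norm_num
    simpa using this
  have h17 : (0:ℤ) ≤ (16:ℤ)^n := by positivity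
  have h18 : (0:ℤ) ≤ (4:ℤ)^q * 16^n := by positivity
  have h19 : (0:ℤ) ≤ (4:ℤ)^r * 16^n := by positivity
  have h20 : (0:ℤ) ≤ (2:ℤ)^q * 2^r * 16^n := by positivity
  have h21 : (0:ℤ) ≤ (5:ℤ)^q * 5^r * 32^n := by positivity
  have h22 : (0:ℤ) ≤ (4:ℤ)^q * 3^r * 16^n := by positivity
  have h23 : (0:ℤ) ≤ (5:ℤ)^q * 2^r * 16^n := by positivity
  have h24 : (0:ℤ) ≤ (5:ℤ)^q * 4^r * 16^n := by positivity
  have h25 : (0:ℤ) ≤ (3:ℤ)^q * 4^r * 16^n := by positivity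
  have h26 : (0:ℤ) ≤ (2:ℤ)^q * 5^r * 16^n := by positivity
  have h27 : (0:ℤ) ≤ (4:ℤ)^q * 5^r * 16^n := by positivity
  unfold G
  simp only [pow_add]
  norm_num
  linarith [h0, h1, h2, h3, h4, h5, h6, h7, h8, h9, h10, h11, h12, h13, h14, h15, h16, h17, h18, h19, h20, h21, h22, h23, h24, h25, h26, h27]

/-- Node n11 of the certificate tree (half-space node): `0 ≤ G 0 (q + 1) r 0 (n + 2)` — the half-spaces `q ≥ 1`, `r ≥ 1`, `n ≥ 1` (direction lemmas `G_n11_d*`) and the remaining single point by `norm_num [G]`. -/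
theorem G_n11 (q r n : ℕ) : 0 ≤ G 0 (q + 1) r 0 (n + 1 + 1) := by
  by_cases hq : 1 ≤ q
  · obtain ⟨q, rfl⟩ := Nat.exists_eq_add_of_le' hq
    exact G_n11_dq q r n
  by_cases hr : 1 ≤ r
  · obtain ⟨r, rfl⟩ := Nat.exists_eq_add_of_le' hr
    exact G_n11_dr q r n
  by_cases hn : 1 ≤ n
  · obtain ⟨n, rfl⟩ := Nat.exists_eq_add_of_le' hn
    exact G_n11_dn q r n
  push Not at hq hr hn
  obtain rfl : q = 0 := by omega
  obtain rfl : r = 0 := by omega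
  obtain rfl : n = 0 := by omega
  norm_num [G]

/-- Node n7 of the certificate tree (case split on `q`): `0 ≤ G 0 q r 0 (n + 2)` — `q = 0` by `G_n8`, `q ≥ 1` by `G_n11`. -/
theorem G_n7 (q r n : ℕ) : 0 ≤ G 0 q r 0 (n + 1 + 1) := by
  rcases Nat.eq_zero_or_pos q with h | h
  · subst h
    exact G_n8 r n
  · obtain ⟨q, rfl⟩ := Nat.exists_eq_add_of_le' h
    exact G_n11 q r n

/-- Node n5 of the certificate tree (case split on `n`): `0 ≤ G 0 q r 0 (n + 1)` — `n = 0` by `G_n6`, `n ≥ 1` by `G_n7`. -/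
theorem G_n5 (q r n : ℕ) : 0 ≤ G 0 q r 0 (n + 1) := by
  rcases Nat.eq_zero_or_pos n with h | h
  · subst h
    exact G_n6 q r
  · obtain ⟨n, rfl⟩ := Nat.exists_eq_add_of_le' h
    exact G_n7 q r n

/-- Node n3 of the certificate tree (case split on `n`): `0 ≤ G 0 q r 0 n` — `n = 0` by `G_n4`, `n ≥ 1` by `G_n5`. -/
theorem G_n3 (q r n : ℕ) : 0 ≤ G 0 q r 0 n := by
  rcases Nat.eq_zero_or_pos n with h | h
  · subst h
    exact G_n4 q r
  · obtain ⟨n, rfl⟩ := Nat.exists_eq_add_of_le' h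
    exact G_n5 q r n

end PercRepro.StarGadget
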